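import Summits.Ventures.PercRepro.C025ProfileFourCapETripleB
/-!
# (Cap) OF RULE E — `|S| = 5` with a collinear triple: the outer pairs and the assembly (night-3 g10)
NIGHT3-G10-CAPE-PROOF.md §4, third part. An OUTER pair `B = {x, c}` (`x ∈ T₀`, `c ∈ S ∖ T₀`) has no point of
`S ∖ B` on its line (`outer_no_point_on_line`), so it pays at most `1/(6(R−3))`, and nothing at all when
`C(min(R, f+1), 2) ≤ C(R−2,2) + (ℓ+f−2−(R−2))(R−3)` (`wE_outer_le`: `crk B ≤ min(R, f+1)` and (G1) with
`|F_B| = ℓ + f − 2`). In the exceptional cell `f = 4`, `N = 5` one point `c` of `S ∖ T₀` is outside the unique parallel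
pair `Y*` of `M／T₀`, and `crk {x, c} ≤ ρ(L₀ ∪ Y*) + 1 = 4` kills the three pairs `{x, c}` (`exists_outer_zero_of_fine`).
The outer total is `k/(6(R−3))` with `k ∈ {0, 3, 6}` (`sum_outer_le`), and `capE_sum_of_card_five_triple` closes the
five-point case through the arithmetic lemma `loadBound_le_one`.
-/
open scoped Matroid
namespace PercRepro
open Set Finset ThmH CapEArith
section CapETripleD
variable {α : Type} [DecidableEq α] {M : Matroid α} [M.Finite]

/-- No point of `S ∖ {x, c}` lies on the line of the outer pair `{x, c}`. -/
theorem outer_no_point_on_line (hsimple : ∀ T ⊆ M.E, T.encard ≤ 2 → M.Indep T) {S T₀ : Finset α}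
    (hS : S ∈ Shadow.levelSet M 4) (h5 : S.card = 5) (hT : T₀ ⊆ S) (hTc : T₀.card = 3)
    (hT2 : M.eRk (T₀ : Set α) = 2) {x c : α} (hx : x ∈ T₀) (hc : c ∈ S \ T₀) :
    ∀ u ∈ S \ ({x, c} : Finset α), u ∉ clF M {x, c} := by
  obtain ⟨hSg, hS4⟩ := Profile.mem_levelSet.1 hS
  rw [Finset.mem_sdiff] at hc
  intro u hu hucl
  rw [Finset.mem_sdiff, Finset.mem_insert, Finset.mem_singleton] at hu
  push Not at hu
  have hxc : x ≠ c := fun h => hc.2 (h ▸ hx)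
  have hxcg : ({x, c} : Finset α) ⊆ gr M :=
    Finset.insert_subset (hSg (hT hx)) (Finset.singleton_subset_iff.2 (hSg hc.1))
  have hxc2 : M.eRk (({x, c} : Finset α) : Set α) = 2 := eRk_pair_eq_two_of_simple hsimple (hSg (hT hx)) (hSg hc.1) hxc
  by_cases huT : u ∈ T₀
  · -- `c ∈ cl {x, u} = cl T₀`, so `c ∈ T₀`
    have h1 : clF M {x, u} = clF M T₀ := clF_pair_eq_of_subset_line hsimple (hT.trans hSg) hT2 (Ne.symm hu.2.1) hx huT
    have h2 : clF M {x, c} = clF M {x, u} := by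
      -- both are the line through `x` and `u`: `{x, c} ⊆ cl {x, u}`? no — use `u ∈ cl {x, c}` and rank 2
      have hxu : ({x, u} : Finset α) ⊆ clF M {x, c} := by
        intro w hw
        rw [Finset.mem_insert, Finset.mem_singleton] at hw
        rcases hw with rfl | rfl
        · exact subset_clF_self hxcg (Finset.mem_insert_self _ _)
        · exact hucl
      have := clF_pair_eq_of_subset_line hsimple (clF_subset_gr _) (by rw [coe_clF, M.eRk_closure_eq, hxc2])
        (Ne.symm hu.2.1) (hxu (Finset.mem_insert_self _ _))
        (hxu (Finset.mem_insert_of_mem (Finset.mem_singleton_self _)))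
      rw [this]
      -- `cl (cl {x, c}) = cl {x, c}`
      apply Finset.coe_injective
      simp only [coe_clF, M.closure_closure]
    have : c ∈ clF M T₀ := by
      rw [← h1, ← h2]; exact subset_clF_self hxcg (Finset.mem_insert_of_mem (Finset.mem_singleton_self _))
    exact hc.2 (mem_triple_of_mem_clF hS h5 hT hTc hT2 hc.1 this)
  · -- `{x, c, u}` is a second rank-`2` triple of `S`
    have hrk : M.eRk ((insert u {x, c} : Finset α) : Set α) = 2 := by
      rw [Finset.coe_insert, eRk_insert_eq_of_mem_closure' (by rw [← coe_clF]; exact_mod_cast hucl), hxc2]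
    have huxc : u ∉ ({x, c} : Finset α) := by
      rw [Finset.mem_insert, Finset.mem_singleton]; push Not; exact ⟨hu.2.1, hu.2.2⟩
    have := eq_of_triple hsimple hS h5 hT hTc hT2 (Finset.insert_subset hu.1 (Finset.insert_subset (hT hx)
      (Finset.singleton_subset_iff.2 hc.1))) (by rw [Finset.card_insert_of_notMem huxc, Finset.card_pair hxc]) hrk
    apply hc.2
    rw [← this]
    exact Finset.mem_insert_of_mem (Finset.mem_insert_of_mem (Finset.mem_singleton_self _))

/-- The ground set has `ℓ + f` points. -/
theorem card_gr_eq (B : Finset α) : (gr M).card = (clF M B).card + (Fs M B).card := by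
  unfold Fs
  rw [← Finset.card_sdiff_add_card_eq_card (clF_subset_gr B), add_comm]

/-- The corank of an outer pair is at most `f + 1`. -/
theorem crk_outer_le {T₀ : Finset α} (hT2 : M.eRk (T₀ : Set α) = 2) {x c : α}
    (hc : c ∈ Fs M T₀) : crk M {x, c} ≤ 2 + ((Fs M T₀).card - 1) := by
  apply crk_le_of_subset_union (X := clF M T₀) (Y := (Fs M T₀).erase c)
  · intro w hw
    rw [Finset.mem_sdiff, Finset.mem_insert, Finset.mem_singleton] at hw
    push Not at hw
    rw [Finset.mem_union, Finset.mem_erase]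
    rcases mem_clF_or_mem_Fs T₀ hw.1 with h | h
    · exact Or.inl h
    · exact Or.inr ⟨hw.2.2, h⟩
  · rw [coe_clF, M.eRk_closure_eq, hT2]; rfl
  · have := eRk_le_card (M := M) ((Fs M T₀).erase c)
    rwa [Finset.card_erase_of_mem hc] at this

/-- **An outer share**: `≤ 1/(6(R−3))`, and `0` under the corank-count condition. -/
theorem wE_outer_le {R : ℕ} (hR : M.eRank = R) (h5R : 5 ≤ R) (hsimple : ∀ T ⊆ M.E, T.encard ≤ 2 → M.Indep T)
    {S T₀ : Finset α} (hS : S ∈ Shadow.levelSet M 4) (h5 : S.card = 5) (hT : T₀ ⊆ S) (hTc : T₀.card = 3)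
    (hT2 : M.eRk (T₀ : Set α) = 2) {x c : α} (hx : x ∈ T₀) (hc : c ∈ S \ T₀) :
    wE M {x, c} S ≤ if Nat.choose (min R ((Fs M T₀).card + 1)) 2 ≤
        Nat.choose (R - 2) 2 + ((clF M T₀).card + (Fs M T₀).card - 2 - (R - 2)) * (R - 3)
      then 0 else 1 / (6 * ((R : ℚ) - 3)) := by
  obtain ⟨hSg, hS4⟩ := Profile.mem_levelSet.1 hS
  have hcT := Finset.mem_sdiff.1 hc
  have hxc : x ≠ c := fun h => hcT.2 (h ▸ hx)
  have hBg : ({x, c} : Finset α) ⊆ gr M :=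
    Finset.insert_subset (hSg (hT hx)) (Finset.singleton_subset_iff.2 (hSg hcT.1))
  have hB2 : M.eRk (({x, c} : Finset α) : Set α) = 2 := eRk_pair_eq_two_of_simple hsimple (hSg (hT hx)) (hSg hcT.1) hxc
  have hBq : ({x, c} : Finset α) ∈ Profile.Rq M 2 := Profile.mem_Rq.2 ⟨hBg, hB2⟩
  have hBS : ({x, c} : Finset α) ⊆ S := Finset.insert_subset (hT hx) (Finset.singleton_subset_iff.2 hcT.1)
  have hBc : ({x, c} : Finset α).card = 2 := Finset.card_pair hxc
  have hSB : (S \ {x, c}).card = 3 := by rw [Finset.card_sdiff_of_subset hBS, h5, hBc]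
  have hno := outer_no_point_on_line hsimple hS h5 hT hTc hT2 hx hc
  have hcF : c ∈ Fs M T₀ := mem_Fs.2 ⟨hSg hcT.1, fun h => hcT.2 (mem_triple_of_mem_clF hS h5 hT hTc hT2 hcT.1 h)⟩
  split_ifs with hcond
  · -- the deficit vanishes: `C(crk, 2) ≤ N_B`
    refine (wE_pair_le_of_card_three hSB hBc hno).trans ?_
    split_ifs with ht
    · have hFs : Fs M {x, c} = gr M \ {x, c} := Fs_eq_of_clF_eq hBg ht
      have hFc : (Fs M {x, c}).card = (clF M T₀).card + (Fs M T₀).card - 2 := by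
        rw [hFs, Finset.card_sdiff_of_subset hBg, card_gr_eq T₀, hBc]
      have hN := card_Gfam_ge hR hBq
      rw [hFc] at hN
      have hcrk1 : crk M {x, c} ≤ R := crk_le_eRank hR _
      have hcrk2 : crk M {x, c} ≤ (Fs M T₀).card + 1 := by
        have := crk_outer_le (x := x) hT2 hcF
        have hf : 1 ≤ (Fs M T₀).card := Finset.card_pos.2 ⟨c, hcF⟩
        omega
      have hcrk : crk M {x, c} ≤ min R ((Fs M T₀).card + 1) := le_min hcrk1 hcrk2
      have hch : Nat.choose (crk M {x, c}) 2 ≤ (Gfam M {x, c}).card :=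
        (Nat.choose_le_choose 2 hcrk).trans (hcond.trans hN)
      have hd : defic M {x, c} = 0 := by
        unfold defic
        rw [price_two_four_eq]
        apply max_eq_left
        split_ifs with h4
        · have : (crk M {x, c} : ℚ) * ((crk M {x, c} : ℚ) - 1) / 12 = ((Nat.choose (crk M {x, c}) 2 : ℕ) : ℚ) / 6 := by
            rw [Nat.cast_choose_two]; ring
          rw [this]
          have : ((Nat.choose (crk M {x, c}) 2 : ℕ) : ℚ) ≤ ((Gfam M {x, c}).card : ℚ) := by exact_mod_cast hch
          linarith
        · have : (0 : ℚ) ≤ ((Gfam M {x, c}).card : ℚ) / 6 := by positivity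
          linarith
      rw [hd, zero_div]
    · exact le_rfl
  · exact wE_pair_le_inv hR (by omega) hBq hSB hBc hno

/-- **The exceptional cell** `f = 4`, `N = 5`: one point `c` of `S ∖ T₀` kills its three outer pairs. -/
theorem exists_outer_zero_of_fine {R : ℕ} (hR : M.eRank = R) (h5R : 5 ≤ R)
    (hsimple : ∀ T ⊆ M.E, T.encard ≤ 2 → M.Indep T) {S T₀ : Finset α} (hS : S ∈ Shadow.levelSet M 4)
    (h5 : S.card = 5) (hT : T₀ ⊆ S) (hTc : T₀.card = 3) (hT2 : M.eRk (T₀ : Set α) = 2)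
    (hf : (Fs M T₀).card = 4) (hN : (Gfam M T₀).card = 5) :
    ∃ c ∈ S \ T₀, ∀ x ∈ T₀, wE M {x, c} S = 0 := by
  obtain ⟨hSg, hS4⟩ := Profile.mem_levelSet.1 hS
  have hTq : T₀ ∈ Profile.Rq M 2 := Profile.mem_Rq.2 ⟨hT.trans hSg, hT2⟩
  -- `R = 5`
  have hR5 : R = 5 := by
    have h1 := card_Gfam_ge hR hTq
    have h2 := card_Fs_ge_of_triple hR hTq
    rw [hf] at h1 h2
    rw [hN] at h1
    have h3 : R ≤ 6 := by omega
    interval_cases R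
    · rfl
    · have : Nat.choose 4 2 = 6 := by decide
      simp only [show 6 - 2 = 4 by norm_num, this] at h1
      omega
  subst hR5
  -- the unique parallel pair `Y*`
  have hpar : (par M T₀).card = 1 := by
    have := card_Gfam_add_card_par (M := M) hT2
    rw [hf, hN] at this
    have h6 : Nat.choose 4 2 = 6 := by decide
    omega
  obtain ⟨Y, hY⟩ := Finset.card_eq_one.1 hpar
  have hYpar : Y ∈ par M T₀ := by rw [hY]; exact Finset.mem_singleton_self _
  obtain ⟨hYF, hYc, hY3⟩ := mem_par.1 hYpar
  have hG := sdiff_mem_Gfam_of_triple hS h5 hT hTc hT2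
  -- `S ∖ T₀ ≠ Y`, so some `c ∈ S ∖ T₀` is outside `Y`
  obtain ⟨c, hcS, hcY⟩ : ∃ c ∈ S \ T₀, c ∉ Y := by
    by_contra hcon
    push Not at hcon
    have hsub : S \ T₀ ⊆ Y := fun c hc => hcon c hc
    have heq : S \ T₀ = Y := Finset.eq_of_subset_of_card_le hsub (by
      rw [hYc, Finset.card_sdiff_of_subset hT, h5, hTc])
    have := Finset.disjoint_left.1 (disjoint_Gfam_par (M := M) T₀) hG
    rw [heq] at this
    exact this hYpar
  refine ⟨c, hcS, fun x hx => ?_⟩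
  have hcT := Finset.mem_sdiff.1 hcS
  have hcF : c ∈ Fs M T₀ := mem_Fs.2 ⟨hSg hcT.1, fun h => hcT.2 (mem_triple_of_mem_clF hS h5 hT hTc hT2 hcT.1 h)⟩
  have hxc : x ≠ c := fun h => hcT.2 (h ▸ hx)
  have hBg : ({x, c} : Finset α) ⊆ gr M :=
    Finset.insert_subset (hSg (hT hx)) (Finset.singleton_subset_iff.2 (hSg hcT.1))
  have hB2 : M.eRk (({x, c} : Finset α) : Set α) = 2 := eRk_pair_eq_two_of_simple hsimple (hSg (hT hx)) (hSg hcT.1) hxc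
  have hBq : ({x, c} : Finset α) ∈ Profile.Rq M 2 := Profile.mem_Rq.2 ⟨hBg, hB2⟩
  have hBS : ({x, c} : Finset α) ⊆ S := Finset.insert_subset (hT hx) (Finset.singleton_subset_iff.2 hcT.1)
  have hBc : ({x, c} : Finset α).card = 2 := Finset.card_pair hxc
  have hSB : (S \ {x, c}).card = 3 := by rw [Finset.card_sdiff_of_subset hBS, h5, hBc]
  have hno := outer_no_point_on_line hsimple hS h5 hT hTc hT2 hx hcS
  -- `crk {x, c} ≤ 4`: `E ∖ {x, c} ⊆ (L₀ ∪ Y) ∪ (F₀ ∖ (Y ∪ {c}))`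
  have hcrk : crk M {x, c} ≤ 3 + 1 := by
    apply crk_le_of_subset_union (X := clF M T₀ ∪ Y) (Y := Fs M T₀ \ insert c Y)
    · intro w hw
      rw [Finset.mem_sdiff, Finset.mem_insert, Finset.mem_singleton] at hw
      push Not at hw
      rw [Finset.mem_union, Finset.mem_union, Finset.mem_sdiff, Finset.mem_insert]
      rcases mem_clF_or_mem_Fs T₀ hw.1 with h | h
      · exact Or.inl (Or.inl h)
      · by_cases hwY : w ∈ Y
        · exact Or.inl (Or.inr hwY)
        · exact Or.inr ⟨h, fun h' => h'.elim hw.2.2 hwY⟩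
    · rw [Finset.coe_union, coe_clF, M.eRk_union_closure_left_eq, ← Finset.coe_union, hY3]
      norm_num
    · have h1 := eRk_le_card (M := M) (Fs M T₀ \ insert c Y)
      have h2 : (Fs M T₀ \ insert c Y).card = 1 := by
        rw [Finset.card_sdiff_of_subset (Finset.insert_subset hcF hYF), hf,
          Finset.card_insert_of_notMem hcY, hYc]
      rw [h2] at h1
      exact h1
  -- the deficit vanishes: `N_B ≥ 7 > 6 ≥ C(crk, 2)`
  apply le_antisymm _ (wE_nonneg _ _)
  refine (wE_pair_le_of_card_three hSB hBc hno).trans ?_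
  split_ifs with ht
  · have hFs : Fs M {x, c} = gr M \ {x, c} := Fs_eq_of_clF_eq hBg ht
    have hFc : (Fs M {x, c}).card = (clF M T₀).card + 4 - 2 := by
      rw [hFs, Finset.card_sdiff_of_subset hBg, card_gr_eq T₀, hBc, hf]
    have hN := card_Gfam_ge hR hBq
    rw [hFc] at hN
    have hℓ : 3 ≤ (clF M T₀).card := by
      have := Finset.card_le_card (subset_clF_self (hT.trans hSg))
      omega
    have h7 : 7 ≤ (Gfam M {x, c}).card := by
      have h3 : Nat.choose (5 - 2) 2 = 3 := by decide
      rw [h3] at hN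
      have : 2 ≤ (clF M T₀).card + 4 - 2 - (5 - 2) := by omega
      have : 2 * (5 - 3) ≤ ((clF M T₀).card + 4 - 2 - (5 - 2)) * (5 - 3) := Nat.mul_le_mul_right _ this
      omega
    have hch : Nat.choose (crk M {x, c}) 2 ≤ (Gfam M {x, c}).card := by
      have := Nat.choose_le_choose 2 hcrk
      have h6 : Nat.choose (3 + 1) 2 = 6 := by decide
      omega
    have hd : defic M {x, c} = 0 := by
      unfold defic
      rw [price_two_four_eq]
      apply max_eq_left
      split_ifs with h4
      · have : (crk M {x, c} : ℚ) * ((crk M {x, c} : ℚ) - 1) / 12 = ((Nat.choose (crk M {x, c}) 2 : ℕ) : ℚ) / 6 := by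
          rw [Nat.cast_choose_two]; ring
        rw [this]
        have : ((Nat.choose (crk M {x, c}) 2 : ℕ) : ℚ) ≤ ((Gfam M {x, c}).card : ℚ) := by exact_mod_cast hch
        linarith
      · have : (0 : ℚ) ≤ ((Gfam M {x, c}).card : ℚ) / 6 := by positivity
        linarith
    rw [hd, zero_div]
  · exact le_rfl

end CapETripleD
end PercRepro
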